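import Literature.NumberTheory.DiophantineGeometry.FunctionFieldGenus
import HarnessLib

/-!
# Rational places of the rational function field `K(X)` — discharge of `infinite_ratPlaces_ratFunc`

Discharge of the named fact `Literature.NumberTheory.DiophantineGeometry.AlgFunctionField.infinite_ratPlaces_ratFunc` stated in
`Literature.NumberTheory.DiophantineGeometry.FunctionFieldGenus` (kept in a sibling file, like the
other discharges of that statement file): over an infinite field `K` the rational function field
`K(X)/K` has infinitely many rational places (places of degree one).

* `AlgFunctionField.PlaceOver.ofPrime K F 𝔭`: the place of `F/K` defined by a nonzero prime `𝔭`
  of a Dedekind domain `R` with `K → R → F = Frac R` (valuation ring = valuation subring of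
  Mathlib's `𝔭`-adic valuation `𝔭.valuation F` = the localisation `R_𝔭 ⊆ F`); for `R = K[X]`,
  `F = K(X)` these are Stichtenoth's places `P_{p(x)}` (1.7)/(1.8). `ofPrime` is injective.
* `AlgFunctionField.idealXSubC a`: the prime `(X - a)` of `K[X]` as a point of the height-one
  spectrum (the analogue of Mathlib's `Polynomial.idealX`, the case `a = 0`).
* `AlgFunctionField.placeXSubC a : PlaceOver K (RatFunc K)`: the place `P_a := P_{X - a}` of
  `K(X)/K` (Stichtenoth (1.9)); `isRational_placeXSubC`: `deg P_a = 1` (Prop. 1.2.1 (b));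
  `placeXSubC_injective`.
* `AlgFunctionField.infinite_ratPlaces_ratFunc_holds : infinite_ratPlaces_ratFunc` (and its
  pointwise form `infinite_ratPlaces_ratFunc_of_infinite`).

## Source and proof (Stichtenoth, *Algebraic Function Fields and Codes*, GTM 254, 2009, §1.2)

* (1.7)/(1.8), p. 9: for a monic irreducible `p(x) ∈ K[x]`,
  `O_{p(x)} := {f/g | f, g ∈ K[x], p ∤ g}` is a valuation ring of `K(x)/K` with maximal ideal
  `P_{p(x)} = {f/g | p ∣ f, p ∤ g}`; (1.9): `P_α := P_{x-α}` for `α ∈ K`.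
* Prop. 1.2.1 (a), p. 9: `p(x)` is a prime element for `P_{p(x)}` and the residue class field
  `O_P/P` is `K[x]/(p(x))` (the map `K[x] → O_P/P` is surjective with kernel `(p)`), so
  `deg P = deg p(x)`; (b): for `p(x) = x - α`, `deg P_α = 1` and the residue class map is
  `z ↦ z(α)`, because `(x - α) ∣ f(x) - f(α)` gives `f(x)(P) = f(α)` for `f ∈ K[x]`.
* Cor. 1.2.3, p. 10: the places of `K(x)/K` of degree one are in 1–1 correspondence with
  `K ∪ {∞}` (`α ↦ P_α`, `∞ ↦ P_∞`).

Hence `α ↦ P_α` injects `K` into the set of rational places, which is therefore infinite when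
`K` is. In Lean: `O_{p(x)}` is Mathlib's `HeightOneSpectrum.valuationSubringAtPrime` (the
localisation of `K[X]` at `(p)` inside `K(X)`), which Mathlib identifies with the valuation
subring of the adic valuation (`valuationSubringAtPrime_eq_valuationSubring`) and which is a DVR
(`IsLocalization.AtPrime.isDiscreteValuationRing_of_dedekind_domain`); the surjectivity of
`K → O_{P_a}/P_a` is Stichtenoth's argument verbatim: an element of `O_{P_a}` is congruent to a
polynomial `f` (`HeightOneSpectrum.exists_valuation_sub_lt_of_integer`, i.e. `z = f/g` with
`g(a) ≠ 0`), and `f ≡ f(a)` since `X - a ∣ f - f(a)` (`Polynomial.X_sub_C_dvd_sub_C_eval`);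
injectivity of `𝔭 ↦ O_𝔭`: equal valuation rings give equivalent valuations
(`Valuation.isEquiv_iff_valuationSubring`), hence equal primes
(`HeightOneSpectrum.eq_of_valuation_isEquiv_valuation`), and `(X - a) = (X - b)` forces `a = b`.
The fact is stated faithfully (Prop. 1.2.1 (b) with Cor. 1.2.3); it is not weakened here.

## References

* H. Stichtenoth, *Algebraic Function Fields and Codes*, 2nd ed., GTM 254, Springer 2009,
  §1.2: (1.7)–(1.9), Prop. 1.2.1, Thm. 1.2.2, Cor. 1.2.3 (pp. 8–10).
  doi:10.1007/978-3-540-76878-4.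
-/

noncomputable section

namespace Literature.NumberTheory.DiophantineGeometry

namespace AlgFunctionField

open Polynomial IsDedekindDomain

universe u v

/-! ### Places from nonzero primes of a Dedekind domain `K ⊆ R ⊆ F = Frac R` -/

section OfPrime

variable (K : Type u) (F : Type v) [Field K] [Field F] [Algebra K F]
variable {R : Type*} [CommRing R] [IsDedekindDomain R] [Algebra R F] [IsFractionRing R F]
  [Algebra K R] [IsScalarTower K R F]

/-- The place of `F/K` defined by a nonzero prime `𝔭` of a Dedekind domain `R` with
`K → R → F = Frac R`: its valuation ring is the valuation subring `{z | v_𝔭(z) ≤ 1}` of Mathlib's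
`𝔭`-adic valuation `𝔭.valuation F`, which is the localisation `R_𝔭 ⊆ F`
(Mathlib `HeightOneSpectrum.valuationSubringAtPrime_eq_valuationSubring`); it is a proper subring
(the adic valuation is nontrivial), a discrete valuation ring (localisation of a Dedekind domain
at a nonzero prime, `IsLocalization.AtPrime.isDiscreteValuationRing_of_dedekind_domain`) and
contains `K ⊆ R`. For `R = K[X]`, `F = K(X)` and `𝔭 = (p(x))` this is Stichtenoth's place
`P_{p(x)}` with valuation ring `O_{p(x)} = {f/g | f, g ∈ K[x], p ∤ g}` ((1.7), (1.8),
Prop. 1.2.1 (a)). [cite: Stichtenoth2009, §1.2 (1.7)–(1.8) and Prop. 1.2.1(a)] -/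
def PlaceOver.ofPrime (𝔭 : HeightOneSpectrum R) : PlaceOver K F where
  toValuationSubring := (𝔭.valuation F).valuationSubring
  ne_top := by
    rw [ne_eq, Valuation.valuationSubring_eq_top_iff, not_not]
    infer_instance
  isDVR := by
    rw [← HeightOneSpectrum.valuationSubringAtPrime_eq_valuationSubring]
    exact IsLocalization.AtPrime.isDiscreteValuationRing_of_dedekind_domain R 𝔭.ne_bot _
  algebraMap_mem c := by
    rw [Valuation.mem_valuationSubring_iff, IsScalarTower.algebraMap_apply K R F]
    exact HeightOneSpectrum.valuation_le_one _ _

variable {K F}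

/-- Membership in the valuation ring of `PlaceOver.ofPrime K F 𝔭`: `z ∈ O_𝔭 ↔ v_𝔭(z) ≤ 1`
(definitional). [folklore] -/
theorem PlaceOver.mem_ofPrime_iff (𝔭 : HeightOneSpectrum R) (z : F) :
    z ∈ (PlaceOver.ofPrime K F 𝔭).toValuationSubring ↔ 𝔭.valuation F z ≤ 1 :=
  Iff.rfl

/-- Elements of `R` lie in the valuation ring of every place `PlaceOver.ofPrime K F 𝔭`.
[folklore] -/
theorem PlaceOver.algebraMap_mem_ofPrime (𝔭 : HeightOneSpectrum R) (r : R) :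
    algebraMap R F r ∈ (PlaceOver.ofPrime K F 𝔭).toValuationSubring :=
  HeightOneSpectrum.valuation_le_one 𝔭 r

/-- Distinct nonzero primes of `R` define distinct places of `F/K`: `𝔭 ↦ O_𝔭` is injective
(equal valuation rings give equivalent adic valuations, `Valuation.isEquiv_iff_valuationSubring`,
hence equal primes, `HeightOneSpectrum.eq_of_valuation_isEquiv_valuation`). For `K(x)/K` this is
the uniqueness part of Stichtenoth Thm. 1.2.2 (`P ∩ K[x] = (p(x))` determines `p`). [folklore] -/
theorem PlaceOver.ofPrime_injective :
    Function.Injective (PlaceOver.ofPrime K F : HeightOneSpectrum R → PlaceOver K F) :=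
  fun _ _ h ↦ HeightOneSpectrum.eq_of_valuation_isEquiv_valuation
    ((Valuation.isEquiv_iff_valuationSubring _ _).2 (congrArg PlaceOver.toValuationSubring h))

end OfPrime

/-! ### The primes `(X - a)` of `K[X]` and the places `P_a` of `K(X)/K` -/

variable {K : Type u} [Field K]

/-- The prime ideal `(X - a)` of `K[X]`, `a ∈ K`, as a point of the height-one spectrum of the
Dedekind domain `K[X]` (the analogue of Mathlib's `Polynomial.idealX`, which is the case `a = 0`).
Its adic valuation `(idealXSubC a).valuation (RatFunc K)` is the valuation `v_{P_a}` of the place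
`P_a = P_{x-a}` of `K(x)/K` (Stichtenoth (1.8), (1.9) and Prop. 1.2.1 (a)).
[cite: Stichtenoth2009, §1.2 (1.8)–(1.9)] -/
def idealXSubC (a : K) : HeightOneSpectrum K[X] where
  asIdeal := Ideal.span {X - C a}
  isPrime := (Ideal.span_singleton_prime (X_sub_C_ne_zero a)).2 (prime_X_sub_C a)
  ne_bot := mt Ideal.span_singleton_eq_bot.1 (X_sub_C_ne_zero a)

/-- The underlying ideal of `idealXSubC a` is `(X - a)` (definitional unfolding). [folklore] -/
@[simp]
theorem idealXSubC_asIdeal (a : K) : (idealXSubC a).asIdeal = Ideal.span {X - C a} :=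
  rfl

/-- At `a = 0` this is Mathlib's `Polynomial.idealX` (the prime `(X)` of `K[X]`). [folklore] -/
theorem idealXSubC_zero : idealXSubC (0 : K) = Polynomial.idealX K := by
  ext : 1
  rw [idealXSubC_asIdeal, Polynomial.idealX_span, map_zero, sub_zero]

/-- `p ∈ (X - a) ↔ p(a) = 0` (`X - a ∣ p` iff `a` is a root of `p`). [folklore] -/
theorem mem_idealXSubC_iff (a : K) (p : K[X]) : p ∈ (idealXSubC a).asIdeal ↔ p.eval a = 0 := by
  rw [idealXSubC_asIdeal, Ideal.mem_span_singleton, dvd_iff_isRoot, IsRoot.def]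

/-- `a ↦ (X - a)` is injective. [folklore] -/
theorem idealXSubC_injective : Function.Injective (idealXSubC (K := K)) := by
  intro a b h
  have hmem : X - C a ∈ (idealXSubC a).asIdeal := Ideal.mem_span_singleton_self _
  rw [h, mem_idealXSubC_iff, eval_sub, eval_X, eval_C, sub_eq_zero] at hmem
  exact hmem.symm

/-- `X - a` is a prime element for `P_a`: its `(X - a)`-adic valuation is `exp (-1)`
(Stichtenoth Prop. 1.2.1 (a): `p(x)` is a prime element of `P_{p(x)}`; Mathlib's `ℤᵐ⁰`-valued
convention `v = exp (-ord)`). [cite: Stichtenoth2009, Prop. 1.2.1(a)] -/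
theorem valuation_idealXSubC_X_sub_C (a : K) :
    (idealXSubC a).valuation (RatFunc K) (RatFunc.X - RatFunc.C a) = WithZero.exp (-1 : ℤ) := by
  rw [← RatFunc.algebraMap_X, ← RatFunc.algebraMap_C, ← map_sub,
    HeightOneSpectrum.valuation_of_algebraMap,
    HeightOneSpectrum.intValuation_singleton _ (X_sub_C_ne_zero a) (idealXSubC_asIdeal a)]

/-- **Stichtenoth Prop. 1.2.1 (b)** (the residue class map of `P_a` is `z ↦ z(a)`): every
`z ∈ K(X)` with `v_{P_a}(z) ≥ 0` is congruent modulo `P_a` to a constant `c ∈ K`, i.e.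
`v_{P_a}(z - c) > 0` (multiplicatively: `< 1`). Proof as printed: `z ≡ f` for a polynomial
`f ∈ K[X]` (write `z = f/g` with `g(a) ≠ 0`; Mathlib
`HeightOneSpectrum.exists_valuation_sub_lt_of_integer`), and `f ≡ f(a)` because
`(X - a) ∣ f - f(a)` (`Polynomial.X_sub_C_dvd_sub_C_eval`). [cite: Stichtenoth2009, Prop. 1.2.1(b)] -/
theorem exists_valuation_idealXSubC_sub_C_lt_one (a : K) {z : RatFunc K}
    (hz : (idealXSubC a).valuation (RatFunc K) z ≤ 1) :
    ∃ c : K, (idealXSubC a).valuation (RatFunc K) (z - RatFunc.C c) < 1 := by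
  obtain ⟨f, hf⟩ := (idealXSubC a).exists_valuation_sub_lt_of_integer hz 1
  refine ⟨f.eval a, ?_⟩
  have h1 : (idealXSubC a).valuation (RatFunc K)
      (algebraMap K[X] (RatFunc K) (f - C (f.eval a))) < 1 :=
    (HeightOneSpectrum.valuation_lt_one_iff_mem _ _).2
      (Ideal.mem_span_singleton.2 X_sub_C_dvd_sub_C_eval)
  rw [map_sub, RatFunc.algebraMap_C] at h1
  have h2 : (idealXSubC a).valuation (RatFunc K) (z - algebraMap K[X] (RatFunc K) f) < 1 := by
    rw [Valuation.map_sub_swap]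
    simpa using hf
  have h := Valuation.map_add_lt _ h2 h1
  rwa [sub_add_sub_cancel] at h

/-- The place `P_a := P_{X - a}` of the rational function field `K(X)/K` attached to `a ∈ K`
(Stichtenoth (1.9)), with valuation ring `O_{X-a} = {f/g | f, g ∈ K[X], (X - a) ∤ g}` ((1.7)):
the place `PlaceOver.ofPrime` of the prime `(X - a)` of `K[X]`.
[cite: Stichtenoth2009, §1.2 (1.7)–(1.9)] -/
def placeXSubC (a : K) : PlaceOver K (RatFunc K) :=
  PlaceOver.ofPrime K (RatFunc K) (idealXSubC a)

/-- Membership in `O_{P_a}`: `z ∈ O_{X-a} ↔ v_{X-a}(z) ≤ 1` (definitional). [folklore] -/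
theorem mem_placeXSubC_iff (a : K) (z : RatFunc K) :
    z ∈ (placeXSubC a).toValuationSubring ↔ (idealXSubC a).valuation (RatFunc K) z ≤ 1 :=
  Iff.rfl

/-- `X - a ∈ O_{P_a}` (indeed in `P_a`). [cite: Stichtenoth2009, Prop. 1.2.1(a)] -/
theorem X_sub_C_mem_placeXSubC (a : K) :
    RatFunc.X - RatFunc.C a ∈ (placeXSubC a).toValuationSubring := by
  rw [mem_placeXSubC_iff, valuation_idealXSubC_X_sub_C, ← WithZero.exp_zero, WithZero.exp_le_exp]
  norm_num

/-- `(X - a)⁻¹ ∉ O_{P_a}` (it has a pole at `P_a`), exhibiting `O_{P_a} ≠ K(X)` explicitly.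
[cite: Stichtenoth2009, Prop. 1.2.1(a)] -/
theorem inv_X_sub_C_notMem_placeXSubC (a : K) :
    (RatFunc.X - RatFunc.C a)⁻¹ ∉ (placeXSubC a).toValuationSubring := by
  rw [mem_placeXSubC_iff, map_inv₀, valuation_idealXSubC_X_sub_C, ← WithZero.exp_neg,
    ← WithZero.exp_zero, WithZero.exp_le_exp]
  norm_num

/-- **Stichtenoth Prop. 1.2.1 (b)**: the place `P_a` of `K(X)/K` is rational, `deg P_a = 1`,
i.e. `K → O_{P_a}/P_a` is a bijection: injective as a ring map out of a field, surjective by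
`exists_valuation_idealXSubC_sub_C_lt_one` (every `z ∈ O_{P_a}` is `≡ z(a) ∈ K` modulo `P_a`).
[cite: Stichtenoth2009, Prop. 1.2.1(b)] -/
theorem isRational_placeXSubC (a : K) : (placeXSubC a).IsRational := by
  apply Module.finrank_of_bijective_algebraMap
  refine ⟨(algebraMap K _).injective, fun r ↦ ?_⟩
  obtain ⟨x, rfl⟩ := IsLocalRing.residue_surjective r
  obtain ⟨c, hc⟩ := exists_valuation_idealXSubC_sub_C_lt_one a (z := (x : RatFunc K)) x.2
  refine ⟨c, ?_⟩
  rw [PlaceOver.algebraMap_residueField_apply, ← sub_eq_zero, ← map_sub,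
    IsLocalRing.residue_eq_zero_iff, IsLocalRing.mem_maximalIdeal, mem_nonunits_iff]
  intro hu
  have h1 := (Valuation.Integers.isUnit_iff_valuation_eq_one
    (Valuation.valuationSubring.integers ((idealXSubC a).valuation (RatFunc K)))).1 hu
  rw [ValuationSubring.algebraMap_apply] at h1
  rw [Valuation.map_sub_swap] at hc
  refine (ne_of_lt ?_) h1
  simpa using hc

/-- `a ↦ P_a` is injective (part of Stichtenoth Cor. 1.2.3: the degree-one places of `K(x)/K`
correspond bijectively to `K ∪ {∞}`), from `PlaceOver.ofPrime_injective` and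
`idealXSubC_injective`. [cite: Stichtenoth2009, Cor. 1.2.3] -/
theorem placeXSubC_injective : Function.Injective (placeXSubC (K := K)) :=
  PlaceOver.ofPrime_injective.comp idealXSubC_injective

/-- Every `P_a` is a rational place: the range of `a ↦ P_a` lies in `ratPlaces K K(X)`.
[cite: Stichtenoth2009, Prop. 1.2.1(b)] -/
theorem placeXSubC_mem_ratPlaces (a : K) : placeXSubC a ∈ ratPlaces K (RatFunc K) :=
  isRational_placeXSubC a

/-- **Discharge of `infinite_ratPlaces_ratFunc`** (Stichtenoth Prop. 1.2.1 (b) with Cor. 1.2.3):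
over an infinite field `K`, the rational function field `K(X)/K` has infinitely many rational
places, since `a ↦ P_a = P_{X-a}` injects `K` into the places of degree one
(`placeXSubC_injective`, `isRational_placeXSubC`; `Set.infinite_of_injective_forall_mem`).
[cite: Stichtenoth2009, Prop. 1.2.1(b) and Cor. 1.2.3 (§1.2, pp. 9–10)] -/
theorem infinite_ratPlaces_ratFunc_holds : infinite_ratPlaces_ratFunc.{u} := by
  intro K _ _
  exact Set.infinite_of_injective_forall_mem (placeXSubC_injective (K := K))
    placeXSubC_mem_ratPlaces

/-- Pointwise form of `infinite_ratPlaces_ratFunc_holds`: for an infinite field `K`, the set of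
rational places of `K(X)/K` is infinite. [cite: Stichtenoth2009, Prop. 1.2.1(b) and Cor. 1.2.3] -/
theorem infinite_ratPlaces_ratFunc_of_infinite (K : Type u) [Field K] [Infinite K] :
    (ratPlaces K (RatFunc K)).Infinite :=
  infinite_ratPlaces_ratFunc_holds K

end AlgFunctionField

end Literature.NumberTheory.DiophantineGeometry
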